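import Literature.AlgebraicGeometry.HodgeTheory.CMHodgeGroupNoTwistThree
import Literature.AlgebraicGeometry.HodgeTheory.CMHodgeGroupKWeilNoOuterTwist
import Literature.AlgebraicGeometry.HodgeTheory.CMHodgeGroupLieSocketTrace
import Literature.AlgebraicGeometry.HodgeTheory.CMHodgeGroupIrreducibleBlocks
import Literature.AlgebraicGeometry.HodgeTheory.WeilTypeCMFieldSlotsHodgeClassesOfLie
import Literature.Algebra.Lie.LieGoursatTwist
import HarnessLib

/-!
# `Lie Hg ⊗ ℂ ⊇ 𝔲_E ∩ 𝔰𝔲_K` for a CM field `E = ℚ[φ]` of degree `4` acting with multiplicity `3`, both places MIXED, of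
# `K`-Weil type along the CM type (the biquadratic pattern `(2,1)+(1,2)` of TABLE X row 11): the LIFT property by
# Goursat–Kolchin–Ribet with both twists killed, and the `SU_K`-socket (Moonen–Zarhin 1998 §4, 1999 (2.3); Ribet 1983 §3)

Family `hodge`, layer `Literature/AlgebraicGeometry/HodgeTheory` (cell `pub-hodgeav-hg6`, req-37 (A) Q2b, TABLE X ROW 11 =
`IV(2,1).kE0`, design note `HOME/jobs/ROW11-Esquare-eng4g8/DESIGN.md`, brick R11-5; lead g3 ruling STATUS l.521: a PRIVATE,
row-11-only instantiation of Ribet's lemma — the `K`-datum is in the hypotheses throughout; no Weil-agnostic NoTwist statement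
is made). UNCONDITIONAL; theorems only, no definition, no named fact, no `sorry`. HONEST FRAMING of that cell: HC / HC_AV /
HC_CM / H2 NOT proved — linear algebra of polarized weight-one `ℚ`-Hodge structures.

SETTING (eng-5 lineage's `CMTheta*` vocabulary): `H` effective polarized of weight `1`, `E = End_Hdg(V) = ℚ[φ]` of dimension
`2|ι|` with every non-zero element invertible, a CM type `μ : ι → ℂ`, `ι = {k₁, k₂}`, with `3`-dimensional blocks `W_{μ k}` BOTH
MIXED (meeting `V^{1,0}` and `V^{0,1}`), an element `y ∈ E` acting by ONE scalar `ν ≠ 0` on `W_{μ k₁}` and `W_{μ k₂}` and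
`ψ`-skew (`K = ℚ(y) ⊂ E` imaginary quadratic, the CM type = the `K`-fibre), the `K`-WEIL BALANCE `(p₁ − q₁) + (p₂ − q₂) = 0`
(`p_k = dim W_{μ k}^{1,0}`, `q_k = dim W_{μ k}^{0,1}`; so `{(p₁,q₁),(p₂,q₂)} = {(2,1),(1,2)}`), and an admissible bracket-closed
`𝔤 ∋ Θ_ℂ` trace-orthogonal to `y` (`Tr(yX) = 0` on `𝔤` — for `𝔤 = Lie Hg` a theorem, `CMThetaKWeil.trace_mul_eq_zero_of_mem_hodgeLie`).
* §1 plumbing: coordinates in a block basis extracted from an adapted dual basis, and the DUALITY OF BLOCK MATRICES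
  `[X|_{W_{μ̄ k}}] = −[X|_{W_{μ k}}]ᵀ` for `ψ_ℂ`-skew block-preserving `X` (`CMThetaKWeil.toMatrix_restrict_conj_eq_neg_transpose`).
* §2 `CMThetaKWeil.exists_equiv_of_matrix_twist` — a matrix twist `[X|₁] = A⁻¹ [X|₂]^e A` (the output of
  `LieGoursatTwist.lift_or_twist_of_submodules`) is an intertwining isomorphism `W₂ ≃ W₁` in the cell's Prop-of-record shape.
* §3 `CMThetaKWeil.finrank_sub_eq_of_intertwiner` — an intertwiner `T : W_a ≃ W_b` of the derived span between a MIXED block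
  `W_a` and a block `W_b` on which `𝔡_ℂ` induces `𝔰𝔩(W_b)` forces EQUAL signatures `p_b − q_b = p_a − q_a` (the defect
  scalar `c(Θ)` of `CMThetaKWeil.exists_defect_of_intertwiner` vanishes since `Θ² = 1` and `Θ|_{W_a}` is not scalar).
* §4 **`CMThetaKWeil.lift_of_twoMixed_kWeil`** — THE LIFT PROPERTY for the setting above: Ribet's lemma at `d = 3` on
  `(W_{μ k₁}, W_{μ k₂})` over the `ψ`-dual adapted bases; TWIST I is an intertwiner `W_{μ k₂} ≃ W_{μ k₁}`, dead by §3
  (`p₁ − q₁ = p₂ − q₂` with the balance gives `p = q`, impossible for `n₀ = 3`); TWIST II transposes (§1) to an intertwiner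
  `W_{μ̄ k₂} ≃ W_{μ k₁}` = `EqualSignatureTwist`, dead by `CMThetaKWeil.not_exists_intertwiner_conj_of_traceOrthogonal` (R11-4).
* §5 **`CMThetaKWeil.mem_spanC_of_commute_of_skew_of_trace_twoMixed`** (admissible `𝔤`) and
  **`CMThetaKWeil.mem_hodgeLieC_of_commute_of_skew_of_trace_twoMixed`** (`𝔤 = Lie Hg`, UNCONDITIONAL): every `φ_ℂ`-commuting
  `ψ_ℂ`-skew `Y` with `tr(Y|_{W_{μk₁}}) + tr(Y|_{W_{μk₂}}) = 0` lies in `𝔤_ℂ` — «`Lie Hg ⊗ ℂ ⊇ (𝔲_E ∩ 𝔰𝔲_K) ⊗ ℂ`» for these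
  members (§4 + the socket `CMThetaSocket.mem_spanC_of_lift_of_trace_add_eq_zero`).
Inputs by name from the eng-5 lineage: `CMNoTwist3.proj_of_exists_mixed` (p701? — `CMHodgeGroupNoTwistThree`), `CMIrred.eigenspace_irreducible`,
`CMTheta.exists_adaptedDualBasis`, `CMDerived.*`; from eng-4: R11-1, R11-2, R11-4.

## References
* [MoonenZarhin1998WeilClasses] B. Moonen, Yu. Zarhin, J. reine angew. Math. 496 (1998), §4 Remark (1).
* [MoonenZarhin1999LowDim] B. Moonen, Yu. Zarhin, Math. Ann. 315 (1999), §2 (2.3), §3 (3.1) and proof of Lemma (3.4).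
* [Ribet1983] K. A. Ribet, Amer. J. Math. 105 (1983), §3 (Lie algebra lemma), Thm. 0.
* [Ribet1976RealMultiplications] K. A. Ribet, Amer. J. Math. 98 (1976), pp. 790–791.
* [Deligne1982HodgeCycles] P. Deligne, LNM 900 (1982), I §3 Prop. 3.4, §4 (p. 30).
* [GoodmanWallachGTM255] R. Goodman, N. R. Wallach, GTM 255 (2009), §4.1.1.
-/

noncomputable section

open scoped TensorProduct
open Module Matrix

namespace Literature.AlgebraicGeometry.Motives

namespace HodgeStructure

open Literature.AlgebraicGeometry.HodgeTheory (exists_basis_eigenspace_of_blocks toMatrix_restrict_eq_of_apply_eq_sum')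

universe u

variable {V : Type u} [AddCommGroup V] [Module ℚ V] {n : ℤ}

/-- `Fin 2 = {0, 1}`. [folklore] -/
private theorem CMThetaKWeil.fin2_cases'' (r : Fin 2) : r = 0 ∨ r = 1 := by
  rcases r with ⟨_ | _ | k, hk⟩
  · exact Or.inl rfl
  · exact Or.inr rfl
  · omega

/-! ### §1 Block bases extracted from an adapted dual basis; duality of block matrices -/

section Blocks

variable {K M : Type*} [Field K] [AddCommGroup M] [Module K M] {T L : Type*} [Fintype L] [DecidableEq L]

/-- **Coordinates in an extracted block basis are coordinates in the big basis**: if `bW : L → W` is a basis with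
`bW ℓ = cb (τ₀, ℓ)`, then `[z]_{bW, ℓ} = [z]_{cb, (τ₀, ℓ)}` for `z ∈ W`. [cite: GoodmanWallachGTM255, §4.1.1] -/
theorem CMThetaKWeil.repr_eq_repr_of_apply_eq (cb : Module.Basis (T × L) K M) {W : Submodule K M} (bW : Module.Basis L K W)
    {τ₀ : T} (hbW : ∀ ℓ, (bW ℓ : M) = cb (τ₀, ℓ)) (z : W) (ℓ : L) : bW.repr z ℓ = cb.repr (z : M) (τ₀, ℓ) := by
  classical
  have hz : (z : M) = ∑ i, bW.repr z i • cb (τ₀, i) := by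
    conv_lhs => rw [← bW.sum_repr z]
    rw [Submodule.coe_sum]
    exact Finset.sum_congr rfl fun i _ => by rw [Submodule.coe_smul, hbW]
  rw [hz, map_sum, Finset.sum_apply']
  simp_rw [map_smul, cb.repr_self, Finsupp.smul_apply, smul_eq_mul, Finsupp.single_apply]
  rw [Finset.sum_eq_single ℓ (fun i _ hiℓ => by rw [if_neg (fun h => hiℓ (Prod.mk.inj h).2), mul_zero])
    (fun h => absurd (Finset.mem_univ ℓ) h)]
  simp

/-- **The matrix of a restriction in an extracted block basis**: `[Y|_W]_{r ℓ} = [Y cb(τ₀, ℓ)]_{cb, (τ₀, r)}`.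
[cite: GoodmanWallachGTM255, §4.1.1] -/
theorem CMThetaKWeil.toMatrix_restrict_apply (cb : Module.Basis (T × L) K M) {W : Submodule K M} (bW : Module.Basis L K W)
    {τ₀ : T} (hbW : ∀ ℓ, (bW ℓ : M) = cb (τ₀, ℓ)) {Y : Module.End K M} (hYW : ∀ x ∈ W, Y x ∈ W) (r ℓ : L) :
    LinearMap.toMatrix bW bW (Y.restrict hYW) r ℓ = cb.repr (Y (cb (τ₀, ℓ))) (τ₀, r) := by
  rw [LinearMap.toMatrix_apply, CMThetaKWeil.repr_eq_repr_of_apply_eq cb bW hbW, LinearMap.coe_restrict_apply, hbW]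

end Blocks

/-- **DUALITY OF BLOCK MATRICES `[X|_{W_{μ̄ k}}] = −[X|_{W_{μ k}}]ᵀ`** in the block bases extracted from an adapted dual basis
(`cb ((k,0),·)` for `W_{μ k}`, `cb ((k,1),·)` for `W_{μ̄ k}`), for a `ψ_ℂ`-skew `X` preserving both blocks: the `(k,1)`-coordinates
are values `ψ_ℂ(cb((k,0),·), −)` (`CMArith.repr_one_eq`) and skewness moves `X` across. (Deligne §4: `ψ` identifies `H¹_σ̄` with
the dual of `H¹_σ`.) [cite: Deligne1982HodgeCycles, §4 (p. 30)] [cite: MoonenZarhin1999LowDim, §1] -/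
theorem CMThetaKWeil.toMatrix_restrict_conj_eq_neg_transpose {ι : Type} [Fintype ι] [DecidableEq ι] {n₀ : ℕ}
    (cb : Module.Basis ((ι × Fin 2) × Fin n₀) ℂ (ℂ ⊗[ℚ] V)) (B : (ℂ ⊗[ℚ] V) →ₗ[ℂ] (ℂ ⊗[ℚ] V) →ₗ[ℂ] ℂ)
    (hdual : ∀ k k' i j, B (cb ((k, 0), i)) (cb ((k', 1), j)) = if k = k' ∧ i = j then 1 else 0)
    (hiso : ∀ k k' (t : Fin 2) i j, B (cb ((k, t), i)) (cb ((k', t), j)) = 0)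
    {W W' : Submodule ℂ (ℂ ⊗[ℚ] V)} (bW : Module.Basis (Fin n₀) ℂ W) (bW' : Module.Basis (Fin n₀) ℂ W') (k : ι)
    (hbW : ∀ ℓ, (bW ℓ : ℂ ⊗[ℚ] V) = cb ((k, 0), ℓ)) (hbW' : ∀ ℓ, (bW' ℓ : ℂ ⊗[ℚ] V) = cb ((k, 1), ℓ))
    {X : Module.End ℂ (ℂ ⊗[ℚ] V)} (hXW : ∀ x ∈ W, X x ∈ W) (hXW' : ∀ x ∈ W', X x ∈ W')
    (hXskew : ∀ x z, B (X x) z + B x (X z) = 0) :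
    LinearMap.toMatrix bW' bW' (X.restrict hXW') = -(LinearMap.toMatrix bW bW (X.restrict hXW))ᵀ := by
  ext r ℓ
  rw [Matrix.neg_apply, Matrix.transpose_apply, CMThetaKWeil.toMatrix_restrict_apply cb bW' hbW' hXW',
    CMThetaKWeil.toMatrix_restrict_apply cb bW hbW hXW, CMArith.repr_one_eq cb B hdual hiso, CMArith.repr_zero_eq cb B hdual hiso]
  linear_combination hXskew (cb ((k, 0), r)) (cb ((k, 1), ℓ))

/-! ### §2 A matrix twist is an intertwining isomorphism -/

/-- **A MATRIX TWIST IS AN INTERTWINING ISOMORPHISM.** If `𝔇 ⊆ End(M)` preserves `W₁`, `W₂` (bases `b₁`, `b₂` of size `d`) and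
`[X|_{W₁}]_{b₁} = A⁻¹ · [X|_{W₂}]_{b₂}^e · A` for all `X ∈ 𝔇` (`A` invertible, `e` a reindexing), then `T := toLin (b₂^e) b₁ A⁻¹`
is a linear isomorphism `W₂ ≃ W₁` with `T(X w) = X(T w)` for all `X ∈ 𝔇`, `w ∈ W₂` — the cell's Prop-of-record shape of a
twist datum. (Operator form of the twist alternative of Ribet's lemma.) [cite: Ribet1983, §3]
[cite: Ribet1976RealMultiplications, pp. 790–791] -/
theorem CMThetaKWeil.exists_equiv_of_matrix_twist {M : Type*} [AddCommGroup M] [Module ℂ M] {d : ℕ}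
    {W₁ W₂ : Submodule ℂ M} (b₁ : Module.Basis (Fin d) ℂ W₁) (b₂ : Module.Basis (Fin d) ℂ W₂)
    (𝔇 : Submodule ℂ (Module.End ℂ M)) (hW₁ : ∀ X ∈ 𝔇, ∀ w ∈ W₁, X w ∈ W₁) (hW₂ : ∀ X ∈ 𝔇, ∀ w ∈ W₂, X w ∈ W₂)
    (e : Fin d ≃ Fin d) {A : Matrix (Fin d) (Fin d) ℂ} (hA : IsUnit A)
    (htw : ∀ X (hX : X ∈ 𝔇), LinearMap.toMatrix b₁ b₁ (X.restrict (hW₁ X hX)) =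
      A⁻¹ * (LinearMap.toMatrix b₂ b₂ (X.restrict (hW₂ X hX))).submatrix e.symm e.symm * A) :
    ∃ T : W₂ ≃ₗ[ℂ] W₁, ∀ X ∈ 𝔇, ∀ w w₁ : W₂, (w₁ : M) = X w → (T w₁ : M) = X (T w) := by
  classical
  set b₂' : Module.Basis (Fin d) ℂ W₂ := b₂.reindex e with hb₂'
  have hsub : ∀ X (hX : X ∈ 𝔇), (LinearMap.toMatrix b₂ b₂ (X.restrict (hW₂ X hX))).submatrix e.symm e.symm =
      LinearMap.toMatrix b₂' b₂' (X.restrict (hW₂ X hX)) := fun X hX => by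
    ext i j
    rw [Matrix.submatrix_apply, LinearMap.toMatrix_apply, LinearMap.toMatrix_apply, hb₂', Module.Basis.reindex_apply,
      Module.Basis.repr_reindex_apply]
  have hAdet : IsUnit A.det := (Matrix.isUnit_iff_isUnit_det A).1 hA
  have hAA : A * A⁻¹ = 1 := Matrix.mul_nonsing_inv A hAdet
  have hAA' : A⁻¹ * A = 1 := Matrix.nonsing_inv_mul A hAdet
  set f : W₂ →ₗ[ℂ] W₁ := Matrix.toLin b₂' b₁ A⁻¹ with hf
  set g : W₁ →ₗ[ℂ] W₂ := Matrix.toLin b₁ b₂' A with hg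
  have hfg : f ∘ₗ g = LinearMap.id := by rw [hf, hg, ← Matrix.toLin_mul b₁ b₂' b₁ A⁻¹ A, hAA', Matrix.toLin_one]
  have hgf : g ∘ₗ f = LinearMap.id := by rw [hf, hg, ← Matrix.toLin_mul b₂' b₁ b₂' A A⁻¹, hAA, Matrix.toLin_one]
  refine ⟨LinearEquiv.ofLinear f g hfg hgf, fun X hX w w₁ hw₁ => ?_⟩
  rw [LinearEquiv.ofLinear_apply, LinearEquiv.ofLinear_apply]
  have hfmat : LinearMap.toMatrix b₂' b₁ f = A⁻¹ := by rw [hf, LinearMap.toMatrix_toLin]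
  have hrel : LinearMap.toMatrix b₁ b₁ (X.restrict (hW₁ X hX)) = A⁻¹ * LinearMap.toMatrix b₂' b₂' (X.restrict (hW₂ X hX)) * A := by
    rw [htw X hX, hsub X hX]
  have hcomp : X.restrict (hW₁ X hX) ∘ₗ f = f ∘ₗ X.restrict (hW₂ X hX) := by
    apply (LinearMap.toMatrix b₂' b₁).injective
    rw [LinearMap.toMatrix_comp b₂' b₁ b₁, LinearMap.toMatrix_comp b₂' b₂' b₁, hfmat, hrel, Matrix.mul_assoc (A⁻¹ * _) A A⁻¹,
      hAA, Matrix.mul_one]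
  have hw₁' : w₁ = X.restrict (hW₂ X hX) w := Subtype.ext (by rw [LinearMap.coe_restrict_apply]; exact hw₁)
  have h := LinearMap.congr_fun hcomp w
  rw [LinearMap.comp_apply, LinearMap.comp_apply, ← hw₁'] at h
  have h' := congrArg Subtype.val h
  rw [LinearMap.coe_restrict_apply] at h'
  exact h'.symm

/-! ### §3 An intertwiner out of a mixed block forces equal signatures -/

/-- **An intertwiner forces equal signatures.** `H` effective polarized of weight `1`, `φ ∈ End_Hdg(V)`, `𝔤` bracket-closed
admissible with `Θ ∈ 𝔤_ℂ`, `W_a`, `W_b` two eigenspaces of `φ_ℂ` with `W_a` MIXED (meets `V^{1,0}` and `V^{0,1}`) and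
`𝔡_ℂ|_{W_b} ⊇ 𝔰𝔩(W_b)`, and `T : W_a ≃ W_b` intertwining `𝔡_ℂ`. Then `dim W_b^{1,0} − dim W_b^{0,1} = dim W_a^{1,0} − dim W_a^{0,1}`:
the defect scalar `c = c(Θ)` (`Θ(Tw) − T(Θw) = c·Tw`, `CMThetaKWeil.exists_defect_of_intertwiner`) satisfies
`2c·Θ + c² = 0` on `W_a` because `Θ² = 1`, so `c = 0` (else `Θ|_{W_a}` is scalar, not mixed), and then
`tr(Θ|_{W_b}) = tr(Θ|_{W_a})` (`CMThetaKWeil.trace_restrict_eq_add_of_intertwiner`, `CMArith.trace_restrict_theta`).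
[cite: MoonenZarhin1999LowDim, §2 (2.3)] [cite: Ribet1983, §3] [cite: Deligne1982HodgeCycles, §4 (p. 30)] -/
theorem CMThetaKWeil.finrank_sub_eq_of_intertwiner [Module.Finite ℚ V] [HodgeTensorFacts.{u, u}] (H : HodgeStructure V n)
    (hn : n = 1) (heff : H.IsEffective) {φ : Module.End ℚ V} (hφE : φ ∈ H.endAlg)
    (𝔤 : Submodule ℚ (Module.End ℚ V)) (hbr : ∀ X ∈ 𝔤, ∀ X' ∈ 𝔤, X * X' - X' * X ∈ 𝔤)
    (hcomm : ∀ X ∈ 𝔤, ∀ e : H.endAlg, X * (e : Module.End ℚ V) = (e : Module.End ℚ V) * X)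
    {Θ : Module.End ℂ (ℂ ⊗[ℚ] V)} (hΘ : ∀ p, ∀ x ∈ H.piece p (n - p), Θ x = ((2 * p - n : ℤ) : ℂ) • x)
    (hΘ𝔤 : Θ ∈ spanC 𝔤) {a b : ℂ}
    (ha10 : Module.finrank ℂ ↥(Module.End.eigenspace (φ.baseChange ℂ) a ⊓ H.piece 1 0) ≠ 0)
    (ha01 : Module.finrank ℂ ↥(Module.End.eigenspace (φ.baseChange ℂ) a ⊓ H.piece 0 1) ≠ 0)
    (hproj : ∀ Z : Module.End ℂ ↥(Module.End.eigenspace (φ.baseChange ℂ) b), LinearMap.trace ℂ _ Z = 0 →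
      ∃ X ∈ spanC (Submodule.span ℚ {B | ∃ X ∈ 𝔤, ∃ X' ∈ 𝔤, X * X' - X' * X = B}),
        ∀ w : ↥(Module.End.eigenspace (φ.baseChange ℂ) b), X w = Z w)
    (T : ↥(Module.End.eigenspace (φ.baseChange ℂ) a) ≃ₗ[ℂ] ↥(Module.End.eigenspace (φ.baseChange ℂ) b))
    (hT : ∀ X ∈ spanC (Submodule.span ℚ {B | ∃ X ∈ 𝔤, ∃ X' ∈ 𝔤, X * X' - X' * X = B}),
      ∀ w w₁ : ↥(Module.End.eigenspace (φ.baseChange ℂ) a), (w₁ : ℂ ⊗[ℚ] V) = X w → (T w₁ : ℂ ⊗[ℚ] V) = X (T w)) :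
    ((Module.finrank ℂ ↥(Module.End.eigenspace (φ.baseChange ℂ) b ⊓ H.piece 1 0) : ℂ) -
        (Module.finrank ℂ ↥(Module.End.eigenspace (φ.baseChange ℂ) b ⊓ H.piece 0 1) : ℂ)) =
      ((Module.finrank ℂ ↥(Module.End.eigenspace (φ.baseChange ℂ) a ⊓ H.piece 1 0) : ℂ) -
        (Module.finrank ℂ ↥(Module.End.eigenspace (φ.baseChange ℂ) a ⊓ H.piece 0 1) : ℂ)) := by
  classical
  obtain ⟨-, -, hΘ10, hΘ01, hΘΘ⟩ := UnitaryTheta.theta_facts H hn heff hΘ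
  have hΘφ : Θ * φ.baseChange ℂ = φ.baseChange ℂ * Θ := UnitaryTheta.commute_of_mem_spanC H hφE hcomm hΘ𝔤
  have hΘW : ∀ c, ∀ w ∈ Module.End.eigenspace (φ.baseChange ℂ) c, Θ w ∈ Module.End.eigenspace (φ.baseChange ℂ) c :=
    fun c w hw => UnitaryTheta.apply_mem_eigenspace_of_commute hΘφ hw
  obtain ⟨c, hc⟩ := CMThetaKWeil.exists_defect_of_intertwiner H hφE 𝔤 hbr hcomm hproj T hT hΘ𝔤
  -- `2c Θ w + c² w = 0` on `W_a`
  have hquad : ∀ w ∈ Module.End.eigenspace (φ.baseChange ℂ) a, (2 * c) • Θ w + (c ^ 2) • w = 0 := by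
    intro w hw
    let w₁ : Module.End.eigenspace (φ.baseChange ℂ) a := ⟨Θ w, hΘW a w hw⟩
    let w₂ : Module.End.eigenspace (φ.baseChange ℂ) a := ⟨Θ (Θ w), hΘW a _ (hΘW a w hw)⟩
    have h1 := hc ⟨w, hw⟩ w₁ rfl
    have h2 := hc w₁ w₂ rfl
    have hw₂w : w₂ = ⟨w, hw⟩ := Subtype.ext (hΘΘ w)
    rw [hw₂w] at h2
    -- `Θ(Θ(Tw)) = Tw`
    have h3 : Θ (Θ (T ⟨w, hw⟩ : ℂ ⊗[ℚ] V)) = (T ⟨w, hw⟩ : ℂ ⊗[ℚ] V) := hΘΘ _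
    -- from h1: Θ(Tw) = T w₁ + c Tw; apply Θ: Tw = Θ(T w₁) + c Θ(Tw) = (Tw + c T w₁) + c (T w₁ + c Tw)
    have e1 : Θ (T ⟨w, hw⟩ : ℂ ⊗[ℚ] V) = (T w₁ : ℂ ⊗[ℚ] V) + c • (T ⟨w, hw⟩ : ℂ ⊗[ℚ] V) := sub_eq_iff_eq_add'.1 h1
    have e2 : Θ (T w₁ : ℂ ⊗[ℚ] V) = (T ⟨w, hw⟩ : ℂ ⊗[ℚ] V) + c • (T w₁ : ℂ ⊗[ℚ] V) := sub_eq_iff_eq_add'.1 h2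
    have h := h3
    rw [e1, map_add, map_smul, e2, e1] at h
    have key : (2 * c) • (T w₁ : ℂ ⊗[ℚ] V) + (c ^ 2) • (T ⟨w, hw⟩ : ℂ ⊗[ℚ] V) =
        ((T ⟨w, hw⟩ : ℂ ⊗[ℚ] V) + c • (T w₁ : ℂ ⊗[ℚ] V) + c • ((T w₁ : ℂ ⊗[ℚ] V) + c • (T ⟨w, hw⟩ : ℂ ⊗[ℚ] V))) -
          (T ⟨w, hw⟩ : ℂ ⊗[ℚ] V) := by
      module
    rw [h, sub_self] at key
    have e4 : (T ((2 * c) • w₁ + (c ^ 2) • ⟨w, hw⟩) : ℂ ⊗[ℚ] V) = 0 := by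
      rw [map_add, map_smul, map_smul, Submodule.coe_add, Submodule.coe_smul, Submodule.coe_smul]
      exact key
    have e5 : (2 * c) • w₁ + (c ^ 2) • (⟨w, hw⟩ : ↥(Module.End.eigenspace (φ.baseChange ℂ) a)) = 0 :=
      (LinearEquiv.map_eq_zero_iff T).1 (Subtype.ext e4)
    have h := congrArg Subtype.val e5
    rw [Submodule.coe_add, Submodule.coe_smul, Submodule.coe_smul] at h
    exact h
  -- `c = 0`: otherwise `Θ` is scalar on the mixed block `W_a`
  have hc0 : c = 0 := by
    by_contra hcne
    obtain ⟨w₁, hw₁, hw₁0⟩ := Submodule.exists_mem_ne_zero_of_ne_bot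
      (fun h => ha10 (by rw [h, finrank_bot]) : Module.End.eigenspace (φ.baseChange ℂ) a ⊓ H.piece 1 0 ≠ ⊥)
    obtain ⟨w₂, hw₂, hw₂0⟩ := Submodule.exists_mem_ne_zero_of_ne_bot
      (fun h => ha01 (by rw [h, finrank_bot]) : Module.End.eigenspace (φ.baseChange ℂ) a ⊓ H.piece 0 1 ≠ ⊥)
    subst hn
    have h1 := hquad w₁ hw₁.1
    rw [hΘ10 w₁ hw₁.2, ← add_smul] at h1
    have h1' : 2 * c + c ^ 2 = 0 := (smul_eq_zero.1 h1).resolve_right hw₁0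
    have h2 := hquad w₂ hw₂.1
    rw [hΘ01 w₂ hw₂.2, smul_neg, ← neg_smul, ← add_smul] at h2
    have h2' : -(2 * c) + c ^ 2 = 0 := (smul_eq_zero.1 h2).resolve_right hw₂0
    have h4 : (4 : ℂ) * c = 0 := by linear_combination h1' - h2'
    exact hcne ((mul_eq_zero.1 h4).resolve_left (by norm_num))
  -- traces
  have htr := CMThetaKWeil.trace_restrict_eq_add_of_intertwiner H hφE 𝔤 hcomm T hΘ𝔤 hc
  rw [hc0, mul_zero, add_zero, CMArith.trace_restrict_theta H hn heff hΘ (hΘW b), CMArith.trace_restrict_theta H hn heff hΘ (hΘW a)]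
    at htr
  exact htr

/-! ### §4 The LIFT property for two mixed places of a `K`-Weil CM type -/

/-- **THE LIFT PROPERTY AT ONE PLACE, TWO MIXED PLACES, `K`-WEIL** (see the module docstring): `ι = {a, b}`, `n₀ = 3`, both
blocks mixed, the `K`-datum `y` (one scalar `ν ≠ 0` on the CM type, `ψ`-skew) with `𝔤` trace-orthogonal to it, and the
balance `(p_a − q_a) + (p_b − q_b) = 0`. Then every traceless endomorphism of `W_{μ a}` is induced by an element of `𝔤_ℂ`
vanishing on `W_{μ b}`: Ribet's lemma (`LieGoursatTwist.lift_or_twist_of_submodules`, `d = 3`, block bases extracted from an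
adapted dual basis) gives LIFT or a twist; a twist of type I is an intertwiner `W_{μ b} ≃ W_{μ a}` and forces
`p_a − q_a = p_b − q_b` (§3), contradicting the balance for `n₀ = 3`; a twist of type II is, after transposition through the
dual basis (§1), an intertwiner `W_{μ̄ b} ≃ W_{μ a}`, excluded by `CMThetaKWeil.not_exists_intertwiner_conj_of_traceOrthogonal`.
[cite: MoonenZarhin1999LowDim, §2 (2.3)] [cite: Ribet1983, §3] [cite: MoonenZarhin1998WeilClasses, §4 Remark (1)]
[cite: Ribet1976RealMultiplications, pp. 790–791] -/
theorem CMThetaKWeil.lift_at_of_twoMixed_kWeil [Module.Finite ℚ V] [HodgeTensorFacts.{u, u}] {ι : Type} [Fintype ι]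
    [DecidableEq ι] (H : HodgeStructure V n) (hn : n = 1) (heff : H.IsEffective) (ψ : H.Polarization)
    {φ : Module.End ℚ V} (hφE : φ ∈ H.endAlg) {m : ℕ} (hE : ∀ a ∈ H.endAlg, ∃ q : Fin m → ℚ, a = ∑ k, q k • φ ^ (k : ℕ))
    (hEdim : Module.finrank ℚ H.endAlg = 2 * Fintype.card ι)
    (hdiv : ∀ a ∈ H.endAlg, a ≠ 0 → ∃ b : Module.End ℚ V, b * a = 1)
    (μ : ι → ℂ) (hinj : Function.Injective μ) (hdist : ∀ k k', μ k' ≠ starRingEnd ℂ (μ k))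
    (hrank : ∀ k, Module.finrank ℂ ↥(Module.End.eigenspace (φ.baseChange ℂ) (μ k) ⊓ H.piece 1 0) +
      Module.finrank ℂ ↥(Module.End.eigenspace (φ.baseChange ℂ) (μ k) ⊓ H.piece 0 1) = 3)
    (htop : (⨆ kt : ι × Fin 2, Module.End.eigenspace (φ.baseChange ℂ)
      (if kt.2 = 0 then μ kt.1 else starRingEnd ℂ (μ kt.1))) = ⊤)
    {y : Module.End ℚ V} (hyskew : ∀ v w, ψ.form (y v) w + ψ.form v (y w) = 0) {ν : ℂ} (hν : ν ≠ 0)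
    (hyν : ∀ k, ∀ w ∈ Module.End.eigenspace (φ.baseChange ℂ) (μ k), y.baseChange ℂ w = ν • w)
    (𝔤 : Submodule ℚ (Module.End ℚ V)) (hbr : ∀ X ∈ 𝔤, ∀ X' ∈ 𝔤, X * X' - X' * X ∈ 𝔤)
    (hcomm : ∀ X ∈ 𝔤, ∀ a : H.endAlg, X * (a : Module.End ℚ V) = (a : Module.End ℚ V) * X)
    (hskew : ∀ X ∈ 𝔤, ∀ v w, ψ.form (X v) w + ψ.form v (X w) = 0)
    {Θ : Module.End ℂ (ℂ ⊗[ℚ] V)} (hΘ : ∀ p, ∀ x ∈ H.piece p (n - p), Θ x = ((2 * p - n : ℤ) : ℂ) • x)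
    (hΘ𝔤 : Θ ∈ spanC 𝔤) (hy𝔤 : ∀ X ∈ 𝔤, LinearMap.trace ℚ V (y * X) = 0)
    (hmixed : ∀ k, Module.finrank ℂ ↥(Module.End.eigenspace (φ.baseChange ℂ) (μ k) ⊓ H.piece 1 0) ≠ 0 ∧
      Module.finrank ℂ ↥(Module.End.eigenspace (φ.baseChange ℂ) (μ k) ⊓ H.piece 0 1) ≠ 0)
    (a b : ι) (hab : a ≠ b) (hι : ∀ k, k = a ∨ k = b)
    (hbal : ((Module.finrank ℂ ↥(Module.End.eigenspace (φ.baseChange ℂ) (μ a) ⊓ H.piece 1 0) : ℤ) -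
        Module.finrank ℂ ↥(Module.End.eigenspace (φ.baseChange ℂ) (μ a) ⊓ H.piece 0 1)) +
      ((Module.finrank ℂ ↥(Module.End.eigenspace (φ.baseChange ℂ) (μ b) ⊓ H.piece 1 0) : ℤ) -
        Module.finrank ℂ ↥(Module.End.eigenspace (φ.baseChange ℂ) (μ b) ⊓ H.piece 0 1)) = 0)
    (Z : Module.End ℂ ↥(Module.End.eigenspace (φ.baseChange ℂ) (μ a))) (hZ : LinearMap.trace ℂ _ Z = 0) :
    ∃ X ∈ spanC 𝔤, (∀ w : ↥(Module.End.eigenspace (φ.baseChange ℂ) (μ a)), X w = Z w) ∧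
      ∀ j, j ≠ a → ∀ w ∈ Module.End.eigenspace (φ.baseChange ℂ) (μ j), X w = 0 := by
  classical
  -- the blocks and the derived span
  let W : ι → Submodule ℂ (ℂ ⊗[ℚ] V) := fun k => Module.End.eigenspace (φ.baseChange ℂ) (μ k)
  set 𝔡 : Submodule ℚ (Module.End ℚ V) := Submodule.span ℚ {B | ∃ X ∈ 𝔤, ∃ X' ∈ 𝔤, X * X' - X' * X = B} with h𝔡
  have h𝔇𝔊 : spanC 𝔡 ≤ spanC 𝔤 := spanC_mono (CMDerived.derived_le hbr)
  have hXφ : ∀ X ∈ 𝔤, X.baseChange ℂ * φ.baseChange ℂ = φ.baseChange ℂ * X.baseChange ℂ := fun X hX =>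
    UnitaryTheta.baseChange_commute H hφE hcomm hX
  have hXW : ∀ X ∈ 𝔤, ∀ c, ∀ w ∈ Module.End.eigenspace (φ.baseChange ℂ) c,
      X.baseChange ℂ w ∈ Module.End.eigenspace (φ.baseChange ℂ) c := fun X hX c w hw =>
    UnitaryTheta.apply_mem_eigenspace_of_commute (hXφ X hX) hw
  have hSφ : ∀ X ∈ spanC 𝔤, X * φ.baseChange ℂ = φ.baseChange ℂ * X := fun X hX =>
    UnitaryTheta.commute_of_mem_spanC H hφE hcomm hX
  have hSW : ∀ X ∈ spanC 𝔤, ∀ c, ∀ w ∈ Module.End.eigenspace (φ.baseChange ℂ) c, X w ∈ Module.End.eigenspace (φ.baseChange ℂ) c :=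
    fun X hX c w hw => UnitaryTheta.apply_mem_eigenspace_of_commute (hSφ X hX) hw
  have hW𝔇 : ∀ X ∈ spanC 𝔡, ∀ k, ∀ w ∈ W k, X w ∈ W k := fun X hX k => hSW X (h𝔇𝔊 hX) (μ k)
  have hW𝔇' : ∀ X ∈ spanC 𝔡, ∀ k, ∀ w ∈ Module.End.eigenspace (φ.baseChange ℂ) (starRingEnd ℂ (μ k)),
      X w ∈ Module.End.eigenspace (φ.baseChange ℂ) (starRingEnd ℂ (μ k)) := fun X hX k => hSW X (h𝔇𝔊 hX) _
  have hskewS : ∀ X ∈ spanC 𝔤, ∀ x z, ψ.form.baseChange ℂ (X x) z + ψ.form.baseChange ℂ x (X z) = 0 := fun X hX x z =>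
    ThetaSubalgebra.formBaseChange_add_eq_zero_of_mem_spanC ψ hskew hX x z
  have hbr𝔇 : ∀ X ∈ spanC 𝔡, ∀ Y ∈ spanC 𝔡, X * Y - Y * X ∈ spanC 𝔡 := fun X hX Y hY =>
    commutator_mem_spanC_derived (h𝔇𝔊 hX) (h𝔇𝔊 hY)
  have htr𝔇 : ∀ X (hX : X ∈ spanC 𝔡) k, LinearMap.trace ℂ _ (X.restrict (hW𝔇 X hX k)) = 0 := fun X hX k =>
    CMDerived.trace_restrict_eq_zero (fun Y hY => hXW Y hY (μ k)) hX _
  -- irreducibility of the blocks and the projections of the derived span (eng-5 lineage)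
  have hirr := fun k => CMIrred.eigenspace_irreducible H hn heff ψ hφE hE μ hinj hdist htop 𝔤 hΘ hΘ𝔤 hcomm hskew k
  have hproj : ∀ k, ∀ Z' : Module.End ℂ ↥(W k), LinearMap.trace ℂ _ Z' = 0 → ∃ X ∈ spanC 𝔡, ∀ w : ↥(W k), X w = Z' w :=
    fun k Z' hZ' => CMNoTwist3.proj_of_exists_mixed H hn heff ψ hφE hE hEdim hdiv μ hinj hdist hrank htop 𝔤 hbr hcomm hskew hΘ
      hΘ𝔤 a (hirr a) (hmixed a).1 (hmixed a).2 k Z' hZ'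
  -- the adapted dual basis and the block bases extracted from it
  obtain ⟨cb, κ, hcbW, hcbW', -, -, hdual, hiso⟩ := CMTheta.exists_adaptedDualBasis H hn heff ψ hφE hE μ hinj hdist hrank htop
  let ev : ι × Fin 2 → ℂ := fun kt => if kt.2 = 0 then μ kt.1 else starRingEnd ℂ (μ kt.1)
  have hev0 : ∀ k, ev (k, 0) = μ k := fun k => by simp [ev]
  have hev1 : ∀ k, ev (k, 1) = starRingEnd ℂ (μ k) := fun k => by simp [ev]
  have hev : Function.Injective ev := by
    rintro ⟨k, t⟩ ⟨k', t'⟩ h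
    rcases CMThetaKWeil.fin2_cases'' t with rfl | rfl <;> rcases CMThetaKWeil.fin2_cases'' t' with rfl | rfl
    · rw [hev0, hev0] at h; rw [hinj h]
    · rw [hev0, hev1] at h; exact absurd h (hdist k' k)
    · rw [hev1, hev0] at h; exact absurd h.symm (hdist k k')
    · rw [hev1, hev1] at h; rw [hinj ((starRingEnd ℂ).injective h)]
  have hcbev : ∀ kt ℓ, cb (kt, ℓ) ∈ Module.End.eigenspace (φ.baseChange ℂ) (ev kt) := by
    rintro ⟨k, t⟩ ℓ
    rcases CMThetaKWeil.fin2_cases'' t with rfl | rfl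
    · rw [hev0]; exact hcbW k ℓ
    · rw [hev1]; exact hcbW' k ℓ
  have hφcb : ∀ kt ℓ, φ.baseChange ℂ (cb (kt, ℓ)) = ev kt • cb (kt, ℓ) := fun kt ℓ =>
    Module.End.mem_eigenspace_iff.1 (hcbev kt ℓ)
  have hbW : ∀ k, ∃ bWk : Module.Basis (Fin 3) ℂ ↥(W k), ∀ ℓ, (bWk ℓ : ℂ ⊗[ℚ] V) = cb ((k, 0), ℓ) := fun k =>
    exists_basis_eigenspace_of_blocks cb (f := φ.baseChange ℂ) (ε := ev) hφcb (k, 0) (μ := μ k) (hev0 k)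
      (fun kt hkt h => hkt (hev (h.trans (hev0 k).symm)))
  choose bW hbW using hbW
  have hbW' : ∀ k, ∃ bWk : Module.Basis (Fin 3) ℂ ↥(Module.End.eigenspace (φ.baseChange ℂ) (starRingEnd ℂ (μ k))),
      ∀ ℓ, (bWk ℓ : ℂ ⊗[ℚ] V) = cb ((k, 1), ℓ) := fun k =>
    exists_basis_eigenspace_of_blocks cb (f := φ.baseChange ℂ) (ε := ev) hφcb (k, 1) (μ := starRingEnd ℂ (μ k)) (hev1 k)
      (fun kt hkt h => hkt (hev (h.trans (hev1 k).symm)))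
  choose bW' hbW' using hbW'
  -- Goursat–Kolchin–Ribet at the place `a`
  rcases Literature.Algebra.Lie.LieGoursatTwist.lift_or_twist_of_submodules (k := ℂ) W (d := 3) (by norm_num) bW (spanC 𝔡) hbr𝔇
      hW𝔇 htr𝔇 hproj a with hlift | ⟨j, hj, e, A, hA, htw⟩
  · obtain ⟨X, hX, h1, h2⟩ := hlift Z hZ
    exact ⟨X, h𝔇𝔊 hX, h1, h2⟩
  exfalso
  obtain rfl : j = b := (hι j).resolve_left hj
  rcases htw with hI | ⟨-, hII⟩
  · -- TWIST I: an intertwiner `W_{μ j} ≃ W_{μ a}` — equal signatures, contradicting the balance for `n₀ = 3`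
    obtain ⟨T, hT⟩ := CMThetaKWeil.exists_equiv_of_matrix_twist (bW a) (bW j) (spanC 𝔡) (fun X hX => hW𝔇 X hX a)
      (fun X hX => hW𝔇 X hX j) e hA hI
    have hsig := CMThetaKWeil.finrank_sub_eq_of_intertwiner H hn heff hφE 𝔤 hbr hcomm hΘ hΘ𝔤 (a := μ j) (b := μ a)
      (hmixed j).1 (hmixed j).2 (hproj a) T hT
    have hsigZ : ((Module.finrank ℂ ↥(Module.End.eigenspace (φ.baseChange ℂ) (μ a) ⊓ H.piece 1 0) : ℤ) -
        Module.finrank ℂ ↥(Module.End.eigenspace (φ.baseChange ℂ) (μ a) ⊓ H.piece 0 1)) =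
      ((Module.finrank ℂ ↥(Module.End.eigenspace (φ.baseChange ℂ) (μ j) ⊓ H.piece 1 0) : ℤ) -
        Module.finrank ℂ ↥(Module.End.eigenspace (φ.baseChange ℂ) (μ j) ⊓ H.piece 0 1)) := by
      exact_mod_cast hsig
    have h3 := hrank a
    omega
  · -- TWIST II: transposed through the dual basis, an intertwiner `W_{μ̄ j} ≃ W_{μ a}` — dead by R11-4
    have hII' : ∀ X (hX : X ∈ spanC 𝔡), LinearMap.toMatrix (bW a) (bW a) (X.restrict (hW𝔇 X hX a)) =
        A⁻¹ * (LinearMap.toMatrix (bW' j) (bW' j) (X.restrict (hW𝔇' X hX j))).submatrix e.symm e.symm * A := by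
      intro X hX
      have hM := CMThetaKWeil.toMatrix_restrict_conj_eq_neg_transpose cb (ψ.form.baseChange ℂ) hdual hiso (bW j) (bW' j) j
        (hbW j) (hbW' j) (hW𝔇 X hX j) (hW𝔇' X hX j) (hskewS X (h𝔇𝔊 hX))
      rw [hII X hX, hM]
      have hneg : (-(LinearMap.toMatrix (bW j) (bW j) (X.restrict (hW𝔇 X hX j)))ᵀ).submatrix e.symm e.symm =
          -((LinearMap.toMatrix (bW j) (bW j) (X.restrict (hW𝔇 X hX j))).submatrix e.symm e.symm)ᵀ := by
        ext i i'
        simp [Matrix.submatrix_apply, Matrix.transpose_apply]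
      rw [hneg, Matrix.mul_neg, Matrix.neg_mul]
    obtain ⟨T, hT⟩ := CMThetaKWeil.exists_equiv_of_matrix_twist (bW a) (bW' j) (spanC 𝔡) (fun X hX => hW𝔇 X hX a)
      (fun X hX => hW𝔇' X hX j) e hA hII'
    exact CMThetaKWeil.not_exists_intertwiner_conj_of_traceOrthogonal H hn heff ψ hφE hE μ hinj hdist (n₀ := 3) (by norm_num)
      hrank htop hyskew hν hyν a j hab hι 𝔤 hbr hcomm hskew hΘ hΘ𝔤 hy𝔤 (hproj a) ⟨T, hT⟩

/-- **THE LIFT PROPERTY FOR TWO MIXED PLACES OF A `K`-WEIL CM TYPE** (at every place; see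
`CMThetaKWeil.lift_at_of_twoMixed_kWeil`) — the input `hlift` of the cell's sockets `CMThetaSocket.*` for TABLE X row 11.
[cite: MoonenZarhin1999LowDim, §2 (2.3)] [cite: Ribet1983, §3 and Thm. 0] [cite: MoonenZarhin1998WeilClasses, §4 Remark (1)] -/
theorem CMThetaKWeil.lift_of_twoMixed_kWeil [Module.Finite ℚ V] [HodgeTensorFacts.{u, u}] {ι : Type} [Fintype ι]
    [DecidableEq ι] (H : HodgeStructure V n) (hn : n = 1) (heff : H.IsEffective) (ψ : H.Polarization)
    {φ : Module.End ℚ V} (hφE : φ ∈ H.endAlg) {m : ℕ} (hE : ∀ a ∈ H.endAlg, ∃ q : Fin m → ℚ, a = ∑ k, q k • φ ^ (k : ℕ))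
    (hEdim : Module.finrank ℚ H.endAlg = 2 * Fintype.card ι)
    (hdiv : ∀ a ∈ H.endAlg, a ≠ 0 → ∃ b : Module.End ℚ V, b * a = 1)
    (μ : ι → ℂ) (hinj : Function.Injective μ) (hdist : ∀ k k', μ k' ≠ starRingEnd ℂ (μ k))
    (hrank : ∀ k, Module.finrank ℂ ↥(Module.End.eigenspace (φ.baseChange ℂ) (μ k) ⊓ H.piece 1 0) +
      Module.finrank ℂ ↥(Module.End.eigenspace (φ.baseChange ℂ) (μ k) ⊓ H.piece 0 1) = 3)
    (htop : (⨆ kt : ι × Fin 2, Module.End.eigenspace (φ.baseChange ℂ)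
      (if kt.2 = 0 then μ kt.1 else starRingEnd ℂ (μ kt.1))) = ⊤)
    {y : Module.End ℚ V} (hyskew : ∀ v w, ψ.form (y v) w + ψ.form v (y w) = 0) {ν : ℂ} (hν : ν ≠ 0)
    (hyν : ∀ k, ∀ w ∈ Module.End.eigenspace (φ.baseChange ℂ) (μ k), y.baseChange ℂ w = ν • w)
    (𝔤 : Submodule ℚ (Module.End ℚ V)) (hbr : ∀ X ∈ 𝔤, ∀ X' ∈ 𝔤, X * X' - X' * X ∈ 𝔤)
    (hcomm : ∀ X ∈ 𝔤, ∀ a : H.endAlg, X * (a : Module.End ℚ V) = (a : Module.End ℚ V) * X)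
    (hskew : ∀ X ∈ 𝔤, ∀ v w, ψ.form (X v) w + ψ.form v (X w) = 0)
    {Θ : Module.End ℂ (ℂ ⊗[ℚ] V)} (hΘ : ∀ p, ∀ x ∈ H.piece p (n - p), Θ x = ((2 * p - n : ℤ) : ℂ) • x)
    (hΘ𝔤 : Θ ∈ spanC 𝔤) (hy𝔤 : ∀ X ∈ 𝔤, LinearMap.trace ℚ V (y * X) = 0)
    (hmixed : ∀ k, Module.finrank ℂ ↥(Module.End.eigenspace (φ.baseChange ℂ) (μ k) ⊓ H.piece 1 0) ≠ 0 ∧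
      Module.finrank ℂ ↥(Module.End.eigenspace (φ.baseChange ℂ) (μ k) ⊓ H.piece 0 1) ≠ 0)
    (k₁ k₂ : ι) (hk : k₁ ≠ k₂) (hι : ∀ k, k = k₁ ∨ k = k₂)
    (hbal : ((Module.finrank ℂ ↥(Module.End.eigenspace (φ.baseChange ℂ) (μ k₁) ⊓ H.piece 1 0) : ℤ) -
        Module.finrank ℂ ↥(Module.End.eigenspace (φ.baseChange ℂ) (μ k₁) ⊓ H.piece 0 1)) +
      ((Module.finrank ℂ ↥(Module.End.eigenspace (φ.baseChange ℂ) (μ k₂) ⊓ H.piece 1 0) : ℤ) -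
        Module.finrank ℂ ↥(Module.End.eigenspace (φ.baseChange ℂ) (μ k₂) ⊓ H.piece 0 1)) = 0)
    (k : ι) (Z : Module.End ℂ ↥(Module.End.eigenspace (φ.baseChange ℂ) (μ k))) (hZ : LinearMap.trace ℂ _ Z = 0) :
    ∃ X ∈ spanC 𝔤, (∀ w : ↥(Module.End.eigenspace (φ.baseChange ℂ) (μ k)), X w = Z w) ∧
      ∀ j, j ≠ k → ∀ w ∈ Module.End.eigenspace (φ.baseChange ℂ) (μ j), X w = 0 := by
  rcases hι k with rfl | rfl
  · exact CMThetaKWeil.lift_at_of_twoMixed_kWeil H hn heff ψ hφE hE hEdim hdiv μ hinj hdist hrank htop hyskew hν hyν 𝔤 hbr hcomm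
      hskew hΘ hΘ𝔤 hy𝔤 hmixed k k₂ hk hι hbal Z hZ
  · exact CMThetaKWeil.lift_at_of_twoMixed_kWeil H hn heff ψ hφE hE hEdim hdiv μ hinj hdist hrank htop hyskew hν hyν 𝔤 hbr hcomm
      hskew hΘ hΘ𝔤 hy𝔤 hmixed k k₁ hk.symm (fun j => (hι j).symm) (by rw [add_comm]; exact hbal) Z hZ

/-! ### §5 The socket: `𝔤_ℂ ⊇ (𝔲_E ∩ 𝔰𝔲_K)_ℂ` -/

/-- **`𝔤_ℂ ⊇ (𝔲_E ∩ 𝔰𝔲_K)_ℂ` FOR TWO MIXED PLACES OF A `K`-WEIL CM TYPE** (admissible `𝔤 ∋ Θ_ℂ` trace-orthogonal to the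
`K`-datum `y`; see the module docstring): every `φ_ℂ`-commuting `ψ_ℂ`-skew operator `Y` with `tr(Y|_{W_{μk₁}}) + tr(Y|_{W_{μk₂}}) = 0`
lies in `𝔤_ℂ` — the LIFT property §4 fed into the socket `CMThetaSocket.mem_spanC_of_lift_of_trace_add_eq_zero`.
[cite: MoonenZarhin1998WeilClasses, §4 Remark (1)] [cite: MoonenZarhin1999LowDim, §2 (2.3)] [cite: Ribet1983, Thm. 0]
[cite: Deligne1982HodgeCycles, I §3 Prop. 3.4 and §4] -/
theorem CMThetaKWeil.mem_spanC_of_commute_of_skew_of_trace_twoMixed [Module.Finite ℚ V] [HodgeTensorFacts.{u, u}] {ι : Type}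
    [Fintype ι] [DecidableEq ι] (H : HodgeStructure V n) (hn : n = 1) (heff : H.IsEffective) (ψ : H.Polarization)
    {φ : Module.End ℚ V} (hφE : φ ∈ H.endAlg) {m : ℕ} (hE : ∀ a ∈ H.endAlg, ∃ q : Fin m → ℚ, a = ∑ k, q k • φ ^ (k : ℕ))
    (hEdim : Module.finrank ℚ H.endAlg = 2 * Fintype.card ι)
    (hdiv : ∀ a ∈ H.endAlg, a ≠ 0 → ∃ b : Module.End ℚ V, b * a = 1)
    (μ : ι → ℂ) (hinj : Function.Injective μ) (hdist : ∀ k k', μ k' ≠ starRingEnd ℂ (μ k))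
    (hrank : ∀ k, Module.finrank ℂ ↥(Module.End.eigenspace (φ.baseChange ℂ) (μ k) ⊓ H.piece 1 0) +
      Module.finrank ℂ ↥(Module.End.eigenspace (φ.baseChange ℂ) (μ k) ⊓ H.piece 0 1) = 3)
    (htop : (⨆ kt : ι × Fin 2, Module.End.eigenspace (φ.baseChange ℂ)
      (if kt.2 = 0 then μ kt.1 else starRingEnd ℂ (μ kt.1))) = ⊤)
    {y : Module.End ℚ V} (hyskew : ∀ v w, ψ.form (y v) w + ψ.form v (y w) = 0) {ν : ℂ} (hν : ν ≠ 0)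
    (hyν : ∀ k, ∀ w ∈ Module.End.eigenspace (φ.baseChange ℂ) (μ k), y.baseChange ℂ w = ν • w)
    (𝔤 : Submodule ℚ (Module.End ℚ V)) (hbr : ∀ X ∈ 𝔤, ∀ X' ∈ 𝔤, X * X' - X' * X ∈ 𝔤)
    (hcomm : ∀ X ∈ 𝔤, ∀ a : H.endAlg, X * (a : Module.End ℚ V) = (a : Module.End ℚ V) * X)
    (hskew : ∀ X ∈ 𝔤, ∀ v w, ψ.form (X v) w + ψ.form v (X w) = 0)
    {Θ : Module.End ℂ (ℂ ⊗[ℚ] V)} (hΘ : ∀ p, ∀ x ∈ H.piece p (n - p), Θ x = ((2 * p - n : ℤ) : ℂ) • x)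
    (hΘ𝔤 : Θ ∈ spanC 𝔤) (hy𝔤 : ∀ X ∈ 𝔤, LinearMap.trace ℚ V (y * X) = 0)
    (hmixed : ∀ k, Module.finrank ℂ ↥(Module.End.eigenspace (φ.baseChange ℂ) (μ k) ⊓ H.piece 1 0) ≠ 0 ∧
      Module.finrank ℂ ↥(Module.End.eigenspace (φ.baseChange ℂ) (μ k) ⊓ H.piece 0 1) ≠ 0)
    (k₁ k₂ : ι) (hk : k₁ ≠ k₂) (hι : ∀ k, k = k₁ ∨ k = k₂)
    (hbal : ((Module.finrank ℂ ↥(Module.End.eigenspace (φ.baseChange ℂ) (μ k₁) ⊓ H.piece 1 0) : ℤ) -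
        Module.finrank ℂ ↥(Module.End.eigenspace (φ.baseChange ℂ) (μ k₁) ⊓ H.piece 0 1)) +
      ((Module.finrank ℂ ↥(Module.End.eigenspace (φ.baseChange ℂ) (μ k₂) ⊓ H.piece 1 0) : ℤ) -
        Module.finrank ℂ ↥(Module.End.eigenspace (φ.baseChange ℂ) (μ k₂) ⊓ H.piece 0 1)) = 0)
    {Y : Module.End ℂ (ℂ ⊗[ℚ] V)} (hYφ : Y * φ.baseChange ℂ = φ.baseChange ℂ * Y)
    (hYskew : ∀ x z, ψ.form.baseChange ℂ (Y x) z + ψ.form.baseChange ℂ x (Y z) = 0)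
    (hYtr : LinearMap.trace ℂ _ (Y.restrict fun x (hx : x ∈ Module.End.eigenspace (φ.baseChange ℂ) (μ k₁)) =>
        UnitaryTheta.apply_mem_eigenspace_of_commute hYφ hx) +
      LinearMap.trace ℂ _ (Y.restrict fun x (hx : x ∈ Module.End.eigenspace (φ.baseChange ℂ) (μ k₂)) =>
        UnitaryTheta.apply_mem_eigenspace_of_commute hYφ hx) = 0) :
    Y ∈ spanC 𝔤 := by
  have ht₁ : Module.finrank ℂ ↥(Module.End.eigenspace (φ.baseChange ℂ) (μ k₁) ⊓ H.piece 1 0) ≠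
      Module.finrank ℂ ↥(Module.End.eigenspace (φ.baseChange ℂ) (μ k₁) ⊓ H.piece 0 1) := by
    have h := hrank k₁; omega
  exact CMThetaSocket.mem_spanC_of_lift_of_trace_add_eq_zero H hn heff ψ hφE hE (n₀ := 3) (by norm_num) μ hinj hdist hrank htop 𝔤
    hcomm hskew hΘ hΘ𝔤 (CMThetaKWeil.lift_of_twoMixed_kWeil H hn heff ψ hφE hE hEdim hdiv μ hinj hdist hrank htop hyskew hν hyν 𝔤
      hbr hcomm hskew hΘ hΘ𝔤 hy𝔤 hmixed k₁ k₂ hk hι hbal) k₁ k₂ hk hι hbal ht₁ hYφ hYskew hYtr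

/-- **`Lie Hg ⊗ ℂ ⊇ (𝔲_E ∩ 𝔰𝔲_K) ⊗ ℂ` FOR TWO MIXED PLACES OF A `K`-WEIL CM TYPE — UNCONDITIONAL** (`𝔤 = Lie Hg(H)`; the
trace-orthogonality to `y` is `CMThetaKWeil.trace_mul_eq_zero_of_mem_hodgeLie`): `H` effective polarized of weight `1`,
`E = End_Hdg(V) = ℚ[φ]` of dimension `2|ι|` with non-zero elements invertible, CM type `μ` with `ι = {k₁, k₂}` and
`3`-dimensional blocks both mixed, `y ∈ E` `ψ`-skew acting by one scalar `ν ≠ 0` on the CM type, balance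
`(p₁ − q₁) + (p₂ − q₂) = 0`. Then every `φ_ℂ`-commuting `ψ_ℂ`-skew `Y` with `tr(Y|_{W_{μk₁}}) + tr(Y|_{W_{μk₂}}) = 0` lies in
`Lie Hg(H) ⊗ ℂ`. (The biquadratic `(2,1)+(1,2)` members of TABLE X row 11, at the level of Hodge structures.)
[cite: MoonenZarhin1998WeilClasses, §4 Remark (1)] [cite: MoonenZarhin1999LowDim, §2 (2.3) and §3 (3.1)] [cite: Ribet1983, Thm. 0] -/
theorem CMThetaKWeil.mem_hodgeLieC_of_commute_of_skew_of_trace_twoMixed [Module.Finite ℚ V] [HodgeTensorFacts.{u, u}] {ι : Type}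
    [Fintype ι] [DecidableEq ι] (H : HodgeStructure V n) (hn : n = 1) (heff : H.IsEffective) (ψ : H.Polarization)
    {φ : Module.End ℚ V} (hφE : φ ∈ H.endAlg) {m : ℕ} (hE : ∀ a ∈ H.endAlg, ∃ q : Fin m → ℚ, a = ∑ k, q k • φ ^ (k : ℕ))
    (hEdim : Module.finrank ℚ H.endAlg = 2 * Fintype.card ι)
    (hdiv : ∀ a ∈ H.endAlg, a ≠ 0 → ∃ b : Module.End ℚ V, b * a = 1)
    (μ : ι → ℂ) (hinj : Function.Injective μ) (hdist : ∀ k k', μ k' ≠ starRingEnd ℂ (μ k))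
    (hrank : ∀ k, Module.finrank ℂ ↥(Module.End.eigenspace (φ.baseChange ℂ) (μ k) ⊓ H.piece 1 0) +
      Module.finrank ℂ ↥(Module.End.eigenspace (φ.baseChange ℂ) (μ k) ⊓ H.piece 0 1) = 3)
    (htop : (⨆ kt : ι × Fin 2, Module.End.eigenspace (φ.baseChange ℂ)
      (if kt.2 = 0 then μ kt.1 else starRingEnd ℂ (μ kt.1))) = ⊤)
    {y : Module.End ℚ V} (hyE : y ∈ H.endAlg) (hyskew : ∀ v w, ψ.form (y v) w + ψ.form v (y w) = 0) {ν : ℂ} (hν : ν ≠ 0)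
    (hyν : ∀ k, ∀ w ∈ Module.End.eigenspace (φ.baseChange ℂ) (μ k), y.baseChange ℂ w = ν • w)
    (hmixed : ∀ k, Module.finrank ℂ ↥(Module.End.eigenspace (φ.baseChange ℂ) (μ k) ⊓ H.piece 1 0) ≠ 0 ∧
      Module.finrank ℂ ↥(Module.End.eigenspace (φ.baseChange ℂ) (μ k) ⊓ H.piece 0 1) ≠ 0)
    (k₁ k₂ : ι) (hk : k₁ ≠ k₂) (hι : ∀ k, k = k₁ ∨ k = k₂)
    (hbal : ((Module.finrank ℂ ↥(Module.End.eigenspace (φ.baseChange ℂ) (μ k₁) ⊓ H.piece 1 0) : ℤ) -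
        Module.finrank ℂ ↥(Module.End.eigenspace (φ.baseChange ℂ) (μ k₁) ⊓ H.piece 0 1)) +
      ((Module.finrank ℂ ↥(Module.End.eigenspace (φ.baseChange ℂ) (μ k₂) ⊓ H.piece 1 0) : ℤ) -
        Module.finrank ℂ ↥(Module.End.eigenspace (φ.baseChange ℂ) (μ k₂) ⊓ H.piece 0 1)) = 0)
    {Y : Module.End ℂ (ℂ ⊗[ℚ] V)} (hYφ : Y * φ.baseChange ℂ = φ.baseChange ℂ * Y)
    (hYskew : ∀ x z, ψ.form.baseChange ℂ (Y x) z + ψ.form.baseChange ℂ x (Y z) = 0)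
    (hYtr : LinearMap.trace ℂ _ (Y.restrict fun x (hx : x ∈ Module.End.eigenspace (φ.baseChange ℂ) (μ k₁)) =>
        UnitaryTheta.apply_mem_eigenspace_of_commute hYφ hx) +
      LinearMap.trace ℂ _ (Y.restrict fun x (hx : x ∈ Module.End.eigenspace (φ.baseChange ℂ) (μ k₂)) =>
        UnitaryTheta.apply_mem_eigenspace_of_commute hYφ hx) = 0) :
    Y ∈ H.hodgeLieC := by
  classical
  have hbalC : ∑ k, ν * (((Module.finrank ℂ ↥(Module.End.eigenspace (φ.baseChange ℂ) (μ k) ⊓ H.piece 1 0)) : ℂ) -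
      (Module.finrank ℂ ↥(Module.End.eigenspace (φ.baseChange ℂ) (μ k) ⊓ H.piece 0 1) : ℂ)) = 0 := by
    have huniv : (Finset.univ : Finset ι) = {k₁, k₂} := by
      ext k
      simp only [Finset.mem_univ, Finset.mem_insert, Finset.mem_singleton, true_iff]
      exact hι k
    rw [huniv, Finset.sum_insert (by rw [Finset.mem_singleton]; exact hk), Finset.sum_singleton, ← mul_add]
    have h := congrArg (fun z : ℤ => (z : ℂ)) hbal
    simp only [Int.cast_add, Int.cast_sub, Int.cast_natCast, Int.cast_zero] at h
    rw [h, mul_zero]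
  have hy𝔤 := CMThetaKWeil.trace_mul_eq_zero_of_mem_hodgeLie H hn heff ψ hφE hE μ hinj hdist hrank htop hyE hyskew (fun _ => ν)
    hyν hbalC
  obtain ⟨Θ, hΘ⟩ := exists_hodgeTheta H
  have hΘ𝔤 : Θ ∈ spanC H.hodgeLie := (hodgeLieC_eq_spanC H) ▸ H.mem_hodgeLieC_of_forall_piece hΘ
  rw [hodgeLieC_eq_spanC]
  exact CMThetaKWeil.mem_spanC_of_commute_of_skew_of_trace_twoMixed H hn heff ψ hφE hE hEdim hdiv μ hinj hdist hrank htop hyskew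
    hν hyν H.hodgeLie (fun X hX X' hX' => H.commutator_mem_hodgeLie hX hX') (fun X hX a => H.commute_of_mem_hodgeLie hX a)
    (fun X hX => form_apply_add_eq_zero_of_mem_hodgeLie ψ hX) hΘ hΘ𝔤 hy𝔤 hmixed k₁ k₂ hk hι hbal hYφ hYskew hYtr

end HodgeStructure

end Literature.AlgebraicGeometry.Motives

end
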